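import Summits.QuantumFields.BalabanUV.T4Continuum.Support.NE7ExactLiftGaugePart
import HarnessLib

/-!
# NE7ExactLiftCurlLetter — THE ONE-STEP CURL LETTER (L2) OF THE EXACT LIFT OF RECORD IN `ℓ²` AT THE FLAT BACKGROUND:
# **`curlSq 1 (exactLift M N w) [0,MN)^d ≤ 2^{d−2}·(M^d∕M⁴)·M^{2d}·curlSq 1 w [0,N)^d`** — curl by the COARSE CURL only, no mass, no gradient (`d = 4`, `M = 2`: constant `1024`)
# (lineage `b2b-balaban-t4-ne7b-p1`, gen 163; route (H′), memo `t4/b2b-balaban-t4-ne7b-p1/g162/records/SCOPING-LEVELMASSES.md` §8 (L2), file (R2))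

Cell `pub-balaban`, rung (B)+1 sub-cell t4, lineage `b2b-balaban-t4-ne7b-p1` (row NE7b OWNER + CRUX PROVER; junction service for row NE7 on ROAD-G116 §6 (G3) ∕ the ℓ² route to (G′)),
generation 163.
WHY.  In the root-form level-mass budget (✓ `NE7LevelMassBudget`) the slice masses `‖J_k‖ ≤ L√C_P·√curlSq(J_k)` need `curlSq(r_k X′_{k+1})` controlled by the COARSE curl energy alone
((L2) of memo §8: otherwise row NE3's slice constant compounds).  ✓ `NE7WhitneyExactLiftFlat.curlAt_flat_exactLift` is the exact de Rham identity `curl_1(r w) = M⁻²·interp(B_c⁻¹ curl_1 w)`;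
THIS FILE turns it into the `ℓ²` letter over the period box: W1a's block sum for the transverse interpolant (✓ `sum_norm_sq_curlAt_flat_whitneyLift_le`, applied to the corrected datum) and
Young's inequality for `B_c⁻¹` (✓ `NE7ExactLiftGaugePart.sum_norm_sq_stencilInv_le`).
WHAT ([folklore]; 0 def, 0 sorry; every `d`, `M, N ≥ 1`): `curlAt_flat_periodic` (the flat curl of a periodic 1-form is periodic), `exactLift_datum_periodic`,
`sum_norm_sq_curlAt_exactLift_le` (one plane), **`curlSq_exactLift_le`** (all planes): `curlSq 1 (exactLift M N w) (periodBox (M·N)) ≤ 2^{d−2}·(M^d∕M⁴)·((1∕(1−2c))²)^d·curlSq 1 w (periodBox N)`,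
and the `d = 4`, `M = 2` numeral `curlSq_exactLift_le_four_two` (`≤ 1024·curlSq 1 w`).
WHAT IS NOT HERE: the curved transport (R4), (K), (G3).
HONEST FRAMING (page 1): flat lattice kinematics of OUR lift; nothing of Bałaban's asserted ([Balaban1985Averaging] (47)–(48) context only); NOT (G3), NOT (G′), NOT NE7∕NE3 as spine nodes; row NE7b
NOT PRINTED ∕ NOT PROVED; spine 0∕9; finite T⁴ rung (B)+1 — NOT infinite volume, NOT mass gap, NOT BetaPertH, NOT Clay.
-/

set_option autoImplicit false

open scoped BigOperators Matrix Matrix.Norms.L2Operator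
open Finset

namespace Summit.QuantumFields.BalabanUV.T4Continuum.NE7ExactLiftCurlLetter

open Literature.MathematicalPhysics.QuantumFieldTheory.Balaban1983to89
open B7Prop1Explicit B7Prop2Explicit
open T4AveragingDeficitWall (curlAt curl curlSq)
open T4AveragingDeficitWallBoundary (periodBox)
open BlockAveragePushDirGauge (gaugeDir)
open BlockAveragePushDirSplit (flat)
open MinimalActionWitness (flatCfg)
open NE3TangentFlatPush (flatCfg_eq_flat)
open NE3SmoothLiftCurl (curlAt_flat_eq)
open NE3CurlOfGaugeDir (curlAt_sub)
open NE7WhitneyLiftFlat (sum_norm_sq_curlAt_flat_whitneyLift_le)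
open NE7WhitneyExactLiftFlat (curlAt_flat_stencilInv curlAt_flat_gaugeDir_flatCfg whitney_c_nonneg whitney_c_lt_half)
open NE7StencilInverse (stencilInv)
open NE7ExactLiftGaugePart (wlift binv theta exactLift binv_periodic theta_periodic gaugeDir_flatCfg_periodic sum_norm_sq_stencilInv_le inv_one_sub_two_c)

noncomputable section

variable {d : ℕ} {n : Type*} [Fintype n] [DecidableEq n]

/-- The flat curl of an `N`-periodic 1-form is `N`-periodic. [folklore] -/
theorem curlAt_flat_periodic {N : ℤ} {w : Site d → Fin d → Matrix n n ℂ} (hw : ∀ (y : Site d) (j κ : Fin d), w (y + N • e j) κ = w y κ)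
    (y : Site d) (j μ ν : Fin d) : curlAt (flat (d := d) (n := n)) w (y + N • e j) μ ν = curlAt (flat (d := d) (n := n)) w y μ ν := by
  simp only [curlAt_flat_eq, add_right_comm _ (N • e j), hw]

/-- The corrected datum of the exact lift is `N`-periodic (`M ≥ 1`). [folklore] -/
theorem exactLift_datum_periodic {M : ℕ} (hM : 1 ≤ M) (N : ℕ) {w : Site d → Fin d → Matrix n n ℂ} (hw : ∀ (y : Site d) (j κ : Fin d), w (y + (N : ℤ) • e j) κ = w y κ)
    (y : Site d) (j κ : Fin d) :
    (fun x κ' => binv M N w x κ' - gaugeDir (flatCfg (d := d) (n := n)) (theta M (binv M N w)) x κ') (y + (N : ℤ) • e j) κ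
      = (fun x κ' => binv M N w x κ' - gaugeDir (flatCfg (d := d) (n := n)) (theta M (binv M N w)) x κ') y κ := by
  simp only [binv_periodic M N hw, gaugeDir_flatCfg_periodic (fun y'' j'' => theta_periodic hM (binv_periodic M N hw) y'' j'')]

/-- **ONE PLANE**: `Σ_{z∈[0,MN)^d} ‖curl_1 (exactLift M N w) (z;μ,ν)‖² ≤ 2^{d−2}·(M^d∕M⁴)·((1∕(1−2c))²)^d·Σ_{y∈[0,N)^d} ‖curl_1 w (y;μ,ν)‖²` (`μ ≠ ν`, `w` `N`-periodic). [folklore] -/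
theorem sum_norm_sq_curlAt_exactLift_le {M N : ℕ} (hM : 1 ≤ M) (hN : 1 ≤ N) {w : Site d → Fin d → Matrix n n ℂ}
    (hw : ∀ (y : Site d) (j κ : Fin d), w (y + (N : ℤ) • e j) κ = w y κ) {μ ν : Fin d} (hμν : μ ≠ ν) :
    ∑ z ∈ periodBox (d := d) (M * N), ‖curlAt (flat (d := d) (n := n)) (exactLift M N w) z μ ν‖ ^ 2
      ≤ 2 ^ (d - 2) * ((M : ℝ) ^ d / (M : ℝ) ^ 4) * (((1 / (1 - 2 * (((M : ℝ) - 1) / (2 * M)))) ^ 2) ^ d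
          * ∑ y ∈ periodBox (d := d) N, ‖curlAt (flat (d := d) (n := n)) w y μ ν‖ ^ 2) := by
  set c : ℝ := ((M : ℝ) - 1) / (2 * M) with hc
  set ψ : Site d → Fin d → Matrix n n ℂ := fun x κ' => binv M N w x κ' - gaugeDir (flatCfg (d := d) (n := n)) (theta M (binv M N w)) x κ' with hψ
  have hψP : ∀ (z : Site d) (τ κ : Fin d), ψ (z + (N : ℤ) • e τ) κ = ψ z κ := fun z τ κ => exactLift_datum_periodic hM N hw z τ κ
  -- the block sum of W1a on the corrected datum
  have h1 := sum_norm_sq_curlAt_flat_whitneyLift_le (n := n) hM hN hψP hμν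
  -- the curl of the corrected datum is the stencil inverse of the coarse curl
  have h2 : ∀ y : Site d, curlAt (flat (d := d) (n := n)) ψ y μ ν = stencilInv N c (fun x => curlAt (flat (d := d) (n := n)) w x μ ν) y := by
    intro y
    rw [hψ, curlAt_sub, curlAt_flat_gaugeDir_flatCfg, sub_zero]
    exact curlAt_flat_stencilInv N c w y μ ν
  have hcP : ∀ (y : Site d) (j : Fin d), curlAt (flat (d := d) (n := n)) w (y + (N : ℤ) • e j) μ ν = curlAt (flat (d := d) (n := n)) w y μ ν :=
    fun y j => curlAt_flat_periodic hw y j μ ν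
  have h3 := sum_norm_sq_stencilInv_le (d := d) hN (whitney_c_nonneg hM) (whitney_c_lt_half hM) (G := fun x => curlAt (flat (d := d) (n := n)) w x μ ν) hcP
  simp only [h2] at h1
  have hexact : (exactLift M N w : Site d → Fin d → Matrix n n ℂ) = fun z κ' => ((M : ℝ)⁻¹) • SmoothRefineInterp.interp M (Finset.univ.erase κ') (fun y => ψ y κ') z := rfl
  rw [hexact]
  exact h1.trans (mul_le_mul_of_nonneg_left h3 (by positivity))

/-- **THE ONE-STEP CURL LETTER (L2)**: `curlSq 1 (exactLift M N w) (periodBox (M·N)) ≤ 2^{d−2}·(M^d∕M⁴)·((1∕(1−2c))²)^d·curlSq 1 w (periodBox N)` (`M, N ≥ 1`, `w` `N`-periodic). [folklore] -/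
theorem curlSq_exactLift_le {M N : ℕ} (hM : 1 ≤ M) (hN : 1 ≤ N) {w : Site d → Fin d → Matrix n n ℂ}
    (hw : ∀ (y : Site d) (j κ : Fin d), w (y + (N : ℤ) • e j) κ = w y κ) :
    curlSq (flatCfg (d := d) (n := n)) (exactLift M N w) (periodBox (d := d) (M * N))
      ≤ 2 ^ (d - 2) * ((M : ℝ) ^ d / (M : ℝ) ^ 4) * (((1 / (1 - 2 * (((M : ℝ) - 1) / (2 * M)))) ^ 2) ^ d
          * curlSq (flatCfg (d := d) (n := n)) w (periodBox (d := d) N)) := by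
  unfold curlSq
  calc ∑ z ∈ periodBox (d := d) (M * N), ∑ π : T4AveragingDeficitWall.Plane d, ‖curl (flatCfg (d := d) (n := n)) (exactLift M N w) (z, π)‖ ^ 2
      = ∑ π : T4AveragingDeficitWall.Plane d, ∑ z ∈ periodBox (d := d) (M * N), ‖curl (flatCfg (d := d) (n := n)) (exactLift M N w) (z, π)‖ ^ 2 := Finset.sum_comm
    _ ≤ ∑ π : T4AveragingDeficitWall.Plane d, 2 ^ (d - 2) * ((M : ℝ) ^ d / (M : ℝ) ^ 4) * (((1 / (1 - 2 * (((M : ℝ) - 1) / (2 * M)))) ^ 2) ^ d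
          * ∑ y ∈ periodBox (d := d) N, ‖curl (flatCfg (d := d) (n := n)) w (y, π)‖ ^ 2) := by
        refine Finset.sum_le_sum fun π _ => ?_
        have hne : π.1.1 ≠ π.1.2 := ne_of_lt π.2
        simp only [curl, flatCfg_eq_flat]
        exact sum_norm_sq_curlAt_exactLift_le hM hN hw hne
    _ = 2 ^ (d - 2) * ((M : ℝ) ^ d / (M : ℝ) ^ 4) * (((1 / (1 - 2 * (((M : ℝ) - 1) / (2 * M)))) ^ 2) ^ d
          * ∑ y ∈ periodBox (d := d) N, ∑ π : T4AveragingDeficitWall.Plane d, ‖curl (flatCfg (d := d) (n := n)) w (y, π)‖ ^ 2) := by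
        rw [← Finset.mul_sum, ← Finset.mul_sum, Finset.sum_comm]

/-- **(L2) AT `d = 4`, `M = 2`**: `curlSq 1 (exactLift 2 N w) (periodBox (2N)) ≤ 1024·curlSq 1 w (periodBox N)`. [folklore] -/
theorem curlSq_exactLift_le_four_two {N : ℕ} (hN : 1 ≤ N) {w : Site 4 → Fin 4 → Matrix n n ℂ}
    (hw : ∀ (y : Site 4) (j κ : Fin 4), w (y + (N : ℤ) • e j) κ = w y κ) :
    curlSq (flatCfg (d := 4) (n := n)) (exactLift 2 N w) (periodBox (d := 4) (2 * N)) ≤ 1024 * curlSq (flatCfg (d := 4) (n := n)) w (periodBox (d := 4) N) := by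
  have h := curlSq_exactLift_le (d := 4) (n := n) (by norm_num : 1 ≤ 2) hN hw
  rw [inv_one_sub_two_c (by norm_num : 1 ≤ 2)] at h
  norm_num at h
  linarith [h]

end

end Summit.QuantumFields.BalabanUV.T4Continuum.NE7ExactLiftCurlLetter
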